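import Summits.HodgeConjecture.HodgeConjecture.Theorems.F0P3cStCharTSShellTracePSH         -- ★ p849597 F1-H (LH6-p01): the binder texts `hbN hbNbar hbexh hR₂ hiff` this file serves
import Literature.NumberTheory.Rogawski1990.LocalNormFibreSurjectiveNonsplit              -- ★ `coe_localNonsplitEquiv_eq_map` (`E₂ g = (matrix of g).map ev_w`, definitional)
import Literature.NumberTheory.Automorphic.UnitaryTwoCartanAnyInvolution                  -- ★ `Two.mem_glInt_iff_forall_v_le_one` (`GL₂(𝒪)` by entries on `U(σ, Φ₂)`)
import Literature.NumberTheory.Automorphic.CMBorelWeylTorusConjugate                      -- ★ `StdForm.antidiagonal_over_apply` pattern (`w₀ · diag(d) = diag(d ∘ rev) · w₀`)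
import HarnessLib

/-!
# F0 · P3c · line LH6 «StCharTS» — road (D), (U2-C) «DOM-GENERAL-H★», PART 1 (package-free clauses): the transversal `R₂`, the Weyl element of
# `U(Φ₂)(L⁺_v)`, Weyl-stability of the levels, and F1-H's `hiff`  [Rogawski1990, §4.9 p. 56; §12.7 L. 12.7.3 (proof) p. 195; §1.10 p. 9]

Cell `pub/hodgecm-mathlib`, crux H413 = `stmt-HodgeConjecture-24833` (lane `--supports … --as helper`), route HCCMUnconditional; seat LH1-p03 (g2) as extra hands of
road (D), block (U2-C) of the road owner LH6-p04 (g3) 2026-09-02T06:40:03Z.  THEOREMS ONLY (no definition, no instance, no notation, no named fact, no `sorry`);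
★-only imports.  HONEST LABEL: HC_CM is proved only modulo the 7 printed citations (2 remaining: hLiu418 = stmt-HodgeConjecture-24832, h413 =
stmt-HodgeConjecture-24833) until rung 0 closes; count-neutral plumbing of road (D).

WHAT IS HERE (the clauses of F1-H ★ `smoothTrace_cmPrincipalSeriesH_indicator_shell_eq_ite` that need NO dominance input), for an ABSTRACT datum
`𝓘₂ : (cmBorelTriple L 2 v).IwahoriDatum` and a normalising compact-open `K₀` as in the (U2-B) package:
* §1 `hR₂` for EVERY `b`: a finite left transversal of `K_n ∕ (K_n ∩ ᵇK_n)` exists (`K_n` compact open; ★ `Representation.exists_isLeftTransversal_conj`).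
* §2 the Weyl element `w₀ ∈ U(Φ₂)(L⁺_v)` with matrix `Φ₂` exists, squares to `1`, conjugates `diag(d₀, d₁)` to `diag(d₁, d₀)` (so it normalises `T₂` and swaps
  H-dominant and `hlevi`-oriented torus points), and lies in any `K₀` described as the `E₂`-preimage of `GL₂(𝒪_w)` (package clause 12 at `N = 2`).
* §3 Weyl-STABILITY of every level `K_n` normalised by `K₀ ∋ w₀` (package clause 6), and F1-H's `hiff` for a pair of torus characters related by `χa = χ₂ ∘ Ad(w₀)`.
The dominance triple `hbN ∕ hbNbar ∕ hbexh` for a GENERAL H-dominant `t ∈ T₂` is NOT derivable from the package clauses (they constrain `𝓘.a` only); it waits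
for the general-diagonal conjunct (G) of (U2-A)∕(U2-B) (bus 06:43Z) — PART 2.

## References
* [Rogawski1990] J. D. Rogawski, *Automorphic Representations of Unitary Groups in Three Variables*, Ann. of Math. Stud. 123 (1990): §1.10 p. 9 (`Φ_N` normalises
  `T`); §4.9 p. 56; §12.7 Lemma 12.7.3 (proof) p. 195.
* [Casselman1995] W. Casselman, *Introduction to the theory of admissible representations of 𝔭-adic reductive groups* (1995 notes), §1.4, §4.1.
-/

set_option autoImplicit false
-- the mandated namespace has the single-problem summit's repeated segment (`HodgeConjecture.HodgeConjecture`)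
set_option linter.dupNamespace false

noncomputable section

open NumberField IsDedekindDomain Topology
open scoped Matrix MatrixGroups Pointwise
open Literature.NumberTheory Literature.NumberTheory.Automorphic Literature.NumberTheory.Automorphic.UnitaryGroup
open Literature.NumberTheory.GaloisRepresentations
open Literature.NumberTheory.Rogawski1990

namespace Summit.HodgeConjecture.HodgeConjecture.Cruxes.H413.F0P3cStCharTSDomGeneralH

variable (L : Type) [Field L] [NumberField L] [IsCMField L] (v : HeightOneSpectrum (𝓞 ↥(maximalRealSubfield L)))

/-! ## §1 F1-H's `hR₂`: a finite left transversal of `K_n ∕ (K_n ∩ ᵇK_n)` exists for every `b` -/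

/-- **F1-H's `hR₂` for every `b ∈ U(Φ₂)(L⁺_v)`**: `K_n` is compact open, so `K_n ∩ bK_nb⁻¹` has finite index in it and a finite left transversal `R₂` exists
(★ `Representation.exists_isLeftTransversal_conj`). [cite: Casselman1995, §4.1] [cite: Rogawski1990, §12.7 L. 12.7.3 (proof) p. 195] -/
theorem exists_isLeftTransversal_K (𝓘₂ : (cmBorelTriple L 2 v).IwahoriDatum) (n : ℕ)
    (b : ↥(unitaryGroupOfForm (conjLocal L (IsCMField.complexConj L) v) (cmLocalForm L 2 v))) :
    ∃ R₂ : Finset ↥(unitaryGroupOfForm (conjLocal L (IsCMField.complexConj L) v) (cmLocalForm L 2 v)),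
      IsLeftTransversal (𝓘₂.K n) (𝓘₂.K n ⊓ ConjAct.toConjAct b • 𝓘₂.K n) R₂ :=
  Representation.exists_isLeftTransversal_conj (𝓘₂.isCompact_K n) (𝓘₂.isOpen_K n) b

/-! ## §2 The Weyl element of `U(Φ₂)(L⁺_v)` -/

/-- **A WEYL ELEMENT EXISTS in `U(Φ₂)(L⁺_v)`**: some `w₀` has matrix `Φ₂ = cmLocalForm L 2 v` (`(σΦ₂)ᵀΦ₂Φ₂ = Φ₂`). [cite: Rogawski1990, §1.10 p. 9] -/
theorem exists_weylElt₂ :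
    ∃ w₀ : ↥(unitaryGroupOfForm (conjLocal L (IsCMField.complexConj L) v) (cmLocalForm L 2 v)),
      Units.val (w₀ : GL (Fin 2) (LocalRing L v)) = cmLocalForm L 2 v := by
  have hJ := cmLocalForm_eq_over L 2 v
  refine ⟨⟨((StdForm.antidiagonal 2).isUnit_over (LocalRing L v)).unit, ?_⟩, ?_⟩
  · rw [mem_unitaryGroupOfForm_iff, IsUnit.unit_spec, hJ, StdForm.over_map, StdForm.transpose_over, StdForm.over_mul_over, Matrix.one_mul]
  · exact (((StdForm.antidiagonal 2).isUnit_over (LocalRing L v)).unit_spec).trans hJ.symm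

variable {w₀ : ↥(unitaryGroupOfForm (conjLocal L (IsCMField.complexConj L) v) (cmLocalForm L 2 v))}
  (hw₀ : Units.val (w₀ : GL (Fin 2) (LocalRing L v)) = cmLocalForm L 2 v)

include hw₀ in
/-- `w₀² = 1` (`Φ₂² = 1`, ★ `StdForm.over_mul_over`). [cite: Rogawski1990, §1.10 p. 9] -/
theorem weylElt₂_mul_self : w₀ * w₀ = 1 := by
  refine Subtype.ext (Units.ext ?_)
  rw [Subgroup.coe_mul, Units.val_mul, hw₀, cmLocalForm_eq_over, StdForm.over_mul_over]
  rfl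

include hw₀ in
/-- `w₀⁻¹ = w₀`. [cite: Rogawski1990, §1.10 p. 9] -/
theorem weylElt₂_inv : w₀⁻¹ = w₀ :=
  inv_eq_of_mul_eq_one_right (weylElt₂_mul_self L v hw₀)

include hw₀ in
/-- **`w₀ · diag(d) = diag(d ∘ rev) · w₀`** in `GL₂(∏ L_w)`: `Φ₂` reverses the diagonal. [cite: Rogawski1990, §1.10 p. 9] -/
theorem coe_weylElt₂_mul_glDiagonal (d : Fin 2 → (LocalRing L v)ˣ) :
    (w₀ : GL (Fin 2) (LocalRing L v)) * glDiagonal 2 (LocalRing L v) d =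
      glDiagonal 2 (LocalRing L v) (fun i => d i.rev) * (w₀ : GL (Fin 2) (LocalRing L v)) := by
  refine Matrix.GeneralLinearGroup.ext fun i j => ?_
  rw [Units.val_mul, Units.val_mul, coe_glDiagonal, coe_glDiagonal, Matrix.mul_diagonal, Matrix.diagonal_mul, hw₀, cmLocalForm_eq_over,
    StdForm.antidiagonal_over_apply]
  by_cases hij : j = i.rev
  · subst hij
    rw [if_pos rfl, one_mul, mul_one]
  · rw [if_neg hij, zero_mul, mul_zero]

include hw₀ in
/-- **`ʷt := w₀ t w₀⁻¹ = diag(d₁, d₀)` for `t = diag(d₀, d₁) ∈ T₂`**: the Weyl conjugate of a diagonal torus element is the reversed diagonal. [cite: Rogawski1990, §1.10 p. 9] -/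
theorem coe_weylConj₂_eq_glDiagonal_rev {t : ↥(unitaryGroupOfForm (conjLocal L (IsCMField.complexConj L) v) (cmLocalForm L 2 v))}
    {d : Fin 2 → (LocalRing L v)ˣ} (hd : glDiagonal 2 (LocalRing L v) d = (t : GL (Fin 2) (LocalRing L v))) :
    ((w₀ * t * w₀⁻¹ : ↥(unitaryGroupOfForm (conjLocal L (IsCMField.complexConj L) v) (cmLocalForm L 2 v))) : GL (Fin 2) (LocalRing L v)) =
      glDiagonal 2 (LocalRing L v) (fun i => d i.rev) := by
  rw [Subgroup.coe_mul, Subgroup.coe_mul, Subgroup.coe_inv, ← hd, coe_weylElt₂_mul_glDiagonal L v hw₀ d, mul_inv_cancel_right]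

include hw₀ in
/-- **`w₀` NORMALISES `T₂ = (cmBorelTriple L 2 v).M`** (and swaps the two diagonal entries: an `hlevi`-oriented point `|d′₁|_w < |d′₀|_w` goes to an H-dominant
one and back). [cite: Rogawski1990, §1.10 p. 9] -/
theorem weylConj₂_mem_cmTorus {t : ↥(unitaryGroupOfForm (conjLocal L (IsCMField.complexConj L) v) (cmLocalForm L 2 v))} (ht : t ∈ (cmBorelTriple L 2 v).M) :
    w₀ * t * w₀⁻¹ ∈ (cmBorelTriple L 2 v).M := by
  obtain ⟨d, hd⟩ := (mem_torusU_iff _).1 ht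
  exact (mem_torusU_iff _).2 ⟨fun i => d i.rev, (coe_weylConj₂_eq_glDiagonal_rev L v hw₀ hd).symm⟩

include hw₀ in
/-- `ʷ(ʷt) = t` (`w₀² = 1`). [cite: Rogawski1990, §1.10 p. 9] -/
theorem weylConj₂_weylConj₂ (t : ↥(unitaryGroupOfForm (conjLocal L (IsCMField.complexConj L) v) (cmLocalForm L 2 v))) :
    w₀ * (w₀ * t * w₀⁻¹) * w₀⁻¹ = t := by
  rw [weylElt₂_inv L v hw₀, ← mul_assoc, ← mul_assoc, weylElt₂_mul_self L v hw₀, one_mul, mul_assoc, weylElt₂_mul_self L v hw₀, mul_one]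

omit [IsCMField L] in
/-- The local form at `w` is `Φ₂` over `L_w`. [cite: Rogawski1990, §1.10 p. 9] -/
theorem placeForm_two_eq (w : PlacesOver L v) :
    placeForm (Matrix.of fun i j : Fin 2 => if i.val + j.val + 1 = 2 then (1 : L) else 0) w.1 = (StdForm.antidiagonal 2).over (w.1.adicCompletion L) := by
  rw [placeForm, antidiagOne_eq_over, StdForm.over_map]

include hw₀ in
/-- **`w₀ ∈ K₀`** for any `K₀` cut out as the `E₂`-preimage of `GL₂(𝒪_w)` (the (U2-B) package clause «`k ∈ K₀ ↔ E₂ k ∈ glInt 2 L_w`» at a non-split `v`): the one-place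
matrix of `w₀` is `Φ₂`, whose entries are `0, 1`. [cite: Rogawski1990, §1.10 p. 9; §12.7 L. 12.7.3 (proof) p. 195] -/
theorem weylElt₂_mem_of_iff_glInt (w : PlacesOver L v) (hw : IsCMField.complexConj L • w.1 = w.1)
    {K₀ : Subgroup ↥(unitaryGroupOfForm (conjLocal L (IsCMField.complexConj L) v) (cmLocalForm L 2 v))}
    (hK₀ : ∀ k : ↥(unitaryGroupOfForm (conjLocal L (IsCMField.complexConj L) v) (cmLocalForm L 2 v)), k ∈ K₀ ↔
      (((localNonsplitEquiv (IsCMField.complexConj L) (Matrix.of fun i j : Fin 2 => if i.val + j.val + 1 = 2 then (1 : L) else 0)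
          (IsCMField.complexConj_ne_one L) w hw) k :
        ↥(unitaryGroupOfForm (galAdicCompletionMap (L := L) (IsCMField.complexConj L) hw)
          (placeForm (Matrix.of fun i j : Fin 2 => if i.val + j.val + 1 = 2 then (1 : L) else 0) w.1))) : GL (Fin 2) (w.1.adicCompletion L)) ∈
        glInt 2 (w.1.adicCompletion L)) :
    w₀ ∈ K₀ := by
  rw [hK₀, Two.mem_glInt_iff_forall_v_le_one (galAdicCompletionMap (L := L) (IsCMField.complexConj L) hw) (placeForm_two_eq L v w)
    (fun x => valued_galAdicCompletionMap (L := L) (IsCMField.complexConj L) hw x)]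
  intro i j
  rw [coe_localNonsplitEquiv_eq_map, Matrix.map_apply]
  change Valued.v ((Pi.evalRingHom (fun w' : PlacesOver L v => w'.1.adicCompletion L) w) (Units.val (w₀ : GL (Fin 2) (LocalRing L v)) i j)) ≤ 1
  rw [hw₀, cmLocalForm_eq_over, StdForm.antidiagonal_over_apply]
  split_ifs
  · rw [map_one, map_one]
  · rw [map_zero, map_zero]; exact zero_le_one

/-! ## §3 Weyl-stability of the levels and F1-H's `hiff` -/

/-- **A level `K_n` normalised by `K₀ ∋ w₀` is Weyl-stable**: `x ∈ K_n ↔ w₀ x w₀⁻¹ ∈ K_n` (package clause 6 «`∀ n, ∀ k ∈ K₀, ∀ κ ∈ K_n, k⁻¹ κ k ∈ K_n`»).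
[cite: Rogawski1990, §12.7 L. 12.7.3 (proof) p. 195] [cite: Casselman1995, §1.4] -/
theorem mem_K_iff_weylConj₂_mem (𝓘₂ : (cmBorelTriple L 2 v).IwahoriDatum)
    {K₀ : Subgroup ↥(unitaryGroupOfForm (conjLocal L (IsCMField.complexConj L) v) (cmLocalForm L 2 v))}
    (hnorm : ∀ n, ∀ k ∈ K₀, ∀ κ ∈ 𝓘₂.K n, k⁻¹ * κ * k ∈ 𝓘₂.K n) (hw₀K : w₀ ∈ K₀) (n : ℕ)
    (x : ↥(unitaryGroupOfForm (conjLocal L (IsCMField.complexConj L) v) (cmLocalForm L 2 v))) :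
    x ∈ 𝓘₂.K n ↔ w₀ * x * w₀⁻¹ ∈ 𝓘₂.K n := by
  constructor
  · intro hx
    have h := hnorm n w₀⁻¹ (K₀.inv_mem hw₀K) x hx
    rwa [inv_inv] at h
  · intro hx
    have h := hnorm n w₀ hw₀K _ hx
    rwa [show w₀⁻¹ * (w₀ * x * w₀⁻¹) * w₀ = x by group] at h

include hw₀ in
/-- **F1-H's `hiff` FROM WEYL-STABILITY**: for torus characters with `χa = χ₂ ∘ Ad(w₀)` on `T₂` (the second exponent of `i₂(χ₂)` is the Weyl conjugate of the first),
`(∀ k ∈ T₂ ∩ K_n, χ₂ k = 1) ↔ (∀ k ∈ T₂ ∩ K_n, χa k = 1)` — the text of ★ `smoothTrace_cmPrincipalSeriesH_indicator_shell_eq_ite`'s `hiff` verbatim.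
[cite: Rogawski1990, §12.7 L. 12.7.3 (proof) p. 195; §12.2 p. 173] -/
theorem hiff_of_weylConj₂ (𝓘₂ : (cmBorelTriple L 2 v).IwahoriDatum)
    {K₀ : Subgroup ↥(unitaryGroupOfForm (conjLocal L (IsCMField.complexConj L) v) (cmLocalForm L 2 v))}
    (hnorm : ∀ n, ∀ k ∈ K₀, ∀ κ ∈ 𝓘₂.K n, k⁻¹ * κ * k ∈ 𝓘₂.K n) (hw₀K : w₀ ∈ K₀) (n : ℕ)
    (χ₂ χa : ↥(torusU (conjLocal L (IsCMField.complexConj L) v) (cmLocalForm L 2 v)) →* ℂˣ)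
    (hχa : ∀ k : ↥(cmBorelTriple L 2 v).M, χa k = χ₂ ⟨w₀ * (k : ↥(unitaryGroupOfForm (conjLocal L (IsCMField.complexConj L) v) (cmLocalForm L 2 v))) * w₀⁻¹,
      weylConj₂_mem_cmTorus L v hw₀ k.2⟩) :
    (∀ k : ↥(cmBorelTriple L 2 v).M, (k : ↥(unitaryGroupOfForm (conjLocal L (IsCMField.complexConj L) v) (cmLocalForm L 2 v))) ∈ 𝓘₂.K n → χ₂ k = 1) ↔
      (∀ k : ↥(cmBorelTriple L 2 v).M, (k : ↥(unitaryGroupOfForm (conjLocal L (IsCMField.complexConj L) v) (cmLocalForm L 2 v))) ∈ 𝓘₂.K n → χa k = 1) := by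
  constructor
  · intro h k hk
    rw [hχa k]
    exact h _ ((mem_K_iff_weylConj₂_mem L v 𝓘₂ hnorm hw₀K n _).1 hk)
  · intro h k hk
    -- `k = ʷ(ʷk)` and `ʷk ∈ T₂ ∩ K_n`
    have hk' : (w₀ * (k : ↥(unitaryGroupOfForm (conjLocal L (IsCMField.complexConj L) v) (cmLocalForm L 2 v))) * w₀⁻¹) ∈ 𝓘₂.K n :=
      (mem_K_iff_weylConj₂_mem L v 𝓘₂ hnorm hw₀K n _).1 hk
    have h1 := h ⟨_, weylConj₂_mem_cmTorus L v hw₀ k.2⟩ hk'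
    rw [hχa] at h1
    have hkk : (⟨w₀ * (w₀ * (k : ↥(unitaryGroupOfForm (conjLocal L (IsCMField.complexConj L) v) (cmLocalForm L 2 v))) * w₀⁻¹) * w₀⁻¹,
        weylConj₂_mem_cmTorus L v hw₀ (weylConj₂_mem_cmTorus L v hw₀ k.2)⟩ : ↥(cmBorelTriple L 2 v).M) = k :=
      Subtype.ext (weylConj₂_weylConj₂ L v hw₀ _)
    rwa [hkk] at h1

end Summit.HodgeConjecture.HodgeConjecture.Cruxes.H413.F0P3cStCharTSDomGeneralH

end
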